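import Literature.AlgebraicGeometry.Motives.AbelianVarietyBlochFiltration
import Literature.AlgebraicGeometry.Motives.AbelianVarietyTranslationProofs
import Literature.AlgebraicGeometry.Motives.AbelianVarietyProjectiveChart
import Literature.AlgebraicGeometry.Motives.AbelianVarietyKummerBound
import Literature.AlgebraicGeometry.Motives.ProjectiveSpaceHyperplaneSection
import Literature.AlgebraicGeometry.Motives.CartierDivisorProjectionFormulaCycle
import Literature.AlgebraicGeometry.Motives.ChowDegree
import Literature.AlgebraicGeometry.Motives.AbelianVarietyKernelDimension
import Literature.AlgebraicGeometry.Motives.ChowZeroSupportedOnHyperplaneSection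
import Literature.AlgebraicGeometry.Motives.CorrespondenceChowAction
import HarnessLib

/-!
# Translated hyperplane sections of an abelian variety: `c₁(t_x^* 𝒪_A(1)) ∩ -` on Chow groups,
# the theorem of the square and the projection formula

Geometric input of the theorem-of-the-square route to Voisin II, Lemma 11.30
(`Gr^l_F CH₀(A) = 0` for `l > dim A`; algebra in `Motives/AbelianVarietyBlochPolynomialMaps`). For a
complex abelian variety `A`, a closed immersion `j : A ↪ ℙ^d_ℂ`
(`AbelianVariety.isProjectiveOver_holds`) and a hyperplane `V₊(ℓ) ⊅ A`, let
`H = V₊(ℓ)|_A` (`(ProjSpace.formDivisor ℓ).pullbackAvoiding j`) and `H_x = t_x^* H` its pull-back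
along the translation `t_x` (`AbelianVariety.translation`, `Q ↦ x Q`). This file proves, on the
tree's Chow groups `CH_n(A) = ChowGroup A.X.left n` (`Motives/Cycles`):

* `AbelianVariety.transHypOp j … x n : CH_{n+1}(A) →+ CH_n(A)` — **`c₁(t_x^*𝒪_A(1)) ∩ -`**, the
  operation `c₁(𝒪(1)) ∩ -` of the translated embedding `t_x ≫ j` (`ProjSpace.hyperplaneSectionOn`,
  Fulton Cor. 2.4.1 / §2.5); `transHypOp_mk`: it is `[c] ↦ [H_x · c]` (Fulton Def. 2.3,
  `CartierDivisor.interCycle`).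
* `AbelianVariety.transHypOp_mul_add` — **the square law**
  `c₁(t_{xy}^*𝒪(1)) ∩ - + c₁(𝒪(1)) ∩ - = c₁(t_x^*𝒪(1)) ∩ - + c₁(t_y^*𝒪(1)) ∩ -`, from the theorem
  of the square `t_{xy}^* H + H ∼ t_x^* H + t_y^* H` (Mumford §6 Cor. 4; the tree's
  `AbelianVariety.theoremOfTheSquare_holds`) and Fulton Prop. 2.3 (b), Def. 2.3 (additivity and
  linear-equivalence invariance of `D · α`, `interCycle_add_sub_mem`,
  `LinEquiv.interCycle_sub_interCycle_mem`).
* `AbelianVariety.pushforward_transHypOp` — **projection formula along `t_x`**: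
  `t_{x*}(c₁(t_x^*𝒪(1)) ∩ α) = c₁(𝒪(1)) ∩ t_{x*} α` (Fulton Prop. 2.3 (c),
  `CartierDivisor.map_interCycle_pullback_sub_mem`).
* `AbelianVariety.fundamentalClass`, `pushforward_translation_fundamentalClass` — `t_{x*}[A] = [A]`;
  `pushforward_translation_pointClass` — `t_{y*}{P} = {y P}`; `ChowGroup.pushforward_congr`,
  `pushforward_translation_inv_comp`.
* `AbelianVariety.exists_eq_sum_pointClass` — every `z ∈ CH₀(A)` is `Σ_{P ∈ J} n_P {P}` with
  `deg z = Σ n_P` (closed points of `A` are complex points, `AbelianVariety.pointOfClosed`;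
  `deg {P} = 1`, `ChowGroup.degree_ofPoint_eq_one`).

Everything is proved; the only definitions are the operator `transHypOp`, its divisor `hypDiv`
and the class `fundamentalClass`. No named facts (D-0026).

## References

* [Fulton1998] W. Fulton, Intersection Theory, 2nd ed. 1998: Def. 2.3, Prop. 2.3 (b), (c) (p. 34),
  Cor. 2.4.1 (p. 38), §2.5 (p. 41), §1.4.
* [MumfordAV1970] D. Mumford, Abelian Varieties (1970), §6 Cor. 4 (theorem of the square).
* [VoisinHodgeII2003] C. Voisin, Hodge Theory and Complex Algebraic Geometry II, CUP 2003,
  Lemma 11.30.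
-/

noncomputable section

universe u

open CategoryTheory AlgebraicGeometry Order
open Literature.AlgebraicGeometry.Motives.Segre Literature.AlgebraicGeometry.Motives.RatFn
open scoped BigOperators

namespace Literature.AlgebraicGeometry.Motives

/-! ### Generalities on proper push-forward -/

namespace ChowGroup

variable {k : Type u} [Field k] {d : ℕ}

/-- Push-forwards along equal morphisms agree. [folklore] -/
theorem pushforward_congr {X Y : SchemeOver k} [LocallyOfFiniteType X.hom] [LocallyOfFiniteType Y.hom]
    {f g : X ⟶ Y} (e : f = g) [IsProper f.left] [IsProper g.left] (z : ChowGroup X.left d) :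
    ChowGroup.pushforward d (map_mem_ratTrivial_holds d) f z =
      ChowGroup.pushforward d (map_mem_ratTrivial_holds d) g z := by
  subst e
  rfl

end ChowGroup

namespace AbelianVariety

open ProjSpace CartierDivisor

variable (A : AbelianVariety ℂ)

attribute [local instance] isProper_toSchemeHom

/-! ### Push-forward along translations -/

/-- `t_{x⁻¹ *} ∘ t_{x*} = id` on `CH_d(A)`. [folklore] -/
theorem pushforward_translation_inv_comp (x : A.Points ℂ) (d : ℕ) (z : ChowGroup A.X.left d) :
    ChowGroup.pushforward d (map_mem_ratTrivial_holds d) (A.translation x⁻¹)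
      (ChowGroup.pushforward d (map_mem_ratTrivial_holds d) (A.translation x) z) = z := by
  haveI : IsIso (A.translation x ≫ A.translation x⁻¹).left := by
    rw [A.translation_comp_translation_inv x]; infer_instance
  rw [← AddMonoidHom.comp_apply, ← ChowGroup.pushforward_comp_holds,
    ChowGroup.pushforward_congr (A.translation_comp_translation_inv x),
    ChowGroup.pushforward_id d (map_mem_ratTrivial_holds d) A.X, AddMonoidHom.id_apply]

/-- **`t_{y*} {P} = {y P}`**: proper push-forward along the translation `t_y` of the class of the
closed point under a complex point `P` is the class of the closed point under `y P`
(`translation_apply_pt`; residue fields `ℂ = ℂ`). [cite: Fulton1998, §1.4] -/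
theorem pushforward_translation_pointClass (y P : A.Points ℂ) :
    ChowGroup.pushforward 0 (map_mem_ratTrivial_holds 0) (A.translation y) (A.pointClass P) =
      A.pointClass (y * P) := by
  rw [pointClass, pointClass, ChowGroup.ofPoint, ChowGroup.ofPoint, ChowGroup.pushforward_mk]
  congr 1
  apply Subtype.ext
  rw [coe_cyclesOfDimMap]
  haveI : LocallyOfFiniteType ((A.translation y).left ≫ A.X.hom) := by
    rw [Over.w (A.translation y)]; infer_instance
  have hsurj : Function.Surjective ((A.translation y).left.residueFieldMap P.pt) :=
    ((ConcreteCategory.isIso_iff_bijective _).mp inferInstance).2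
  rw [algebraicCycleMap_primeCycle_of_residueFieldMap_surjective (A.translation y).left A.X.hom
    P.pt hsurj]
  congr 1
  exact A.translation_apply_pt P y

/-! ### The fundamental class -/

/-- `dim A = height` of the generic point of `A` (in the specialisation order). [folklore] -/
theorem height_genericPoint_eq_dim : height (genericPoint A.X.left) = (A.dim : ℕ∞) := by
  haveI := irreducibleSpace_left A
  have h : (height (genericPoint A.X.left) : WithBot ℕ∞) = A.dim := by
    rw [Scheme.height_genericPoint, topologicalKrullDim_left]
  exact_mod_cast h

/-- **The fundamental class `[A] ∈ CH_{dim A}(A)`**, the class of the generic point. [folklore] -/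
def fundamentalClass : ChowGroup A.X.left A.dim :=
  ChowGroup.ofPoint (genericPoint A.X.left) A.height_genericPoint_eq_dim

/-- **`t_{x*}[A] = [A]`** (an automorphism fixes the generic point and has trivial residue
extension there). [folklore] -/
theorem pushforward_translation_fundamentalClass (x : A.Points ℂ) :
    ChowGroup.pushforward A.dim (map_mem_ratTrivial_holds A.dim) (A.translation x) A.fundamentalClass =
      A.fundamentalClass := by
  rw [fundamentalClass, ChowGroup.ofPoint, ChowGroup.pushforward_mk]
  congr 1
  apply Subtype.ext
  rw [coe_cyclesOfDimMap]
  haveI : LocallyOfFiniteType ((A.translation x).left ≫ A.X.hom) := by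
    rw [Over.w (A.translation x)]; infer_instance
  have hsurj : Function.Surjective ((A.translation x).left.residueFieldMap (genericPoint A.X.left)) :=
    ((ConcreteCategory.isIso_iff_bijective _).mp inferInstance).2
  rw [algebraicCycleMap_primeCycle_of_residueFieldMap_surjective (A.translation x).left A.X.hom
    (genericPoint A.X.left) hsurj]
  congr 1
  haveI := irreducibleSpace_left A
  exact RatFn.genericPoint_eq_of_isDominant (A.translation x).left

/-! ### `CH₀(A)` is spanned by the classes of complex points -/

/-- Classes of equal points agree (the dimension witnesses are irrelevant). [folklore] -/
theorem _root_.Literature.AlgebraicGeometry.Motives.ChowGroup.ofPoint_congr {X : Scheme.{u}} {d : ℕ}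
    {z z' : X} (e : z' = z) (h : height z = d) (h' : height z' = d) :
    ChowGroup.ofPoint z' h' = ChowGroup.ofPoint z h := by
  subst e; rfl

/-- The class `{P}` of a complex point is the class of the closed point `P.pt` (unfolding).
[folklore] -/
theorem pointClass_eq_ofPoint (P : A.Points ℂ) :
    A.pointClass P = ChowGroup.ofPoint P.pt (HodgeTheory.height_pt_eq_zero P) := rfl

/-- **Every `0`-cycle class on `A` is an integral combination of classes of complex points, with
degree the sum of the coefficients**: `z = Σ_{P ∈ J} n_P {P}` and `deg z = Σ_{P ∈ J} n_P` (closed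
points of the finite-type `ℂ`-scheme `A` are complex points; `deg {P} = 1` over `ℂ`).
[cite: Fulton1998, Definition 1.4 (p. 13)] -/
theorem exists_eq_sum_pointClass (z : ChowGroup A.X.left 0) :
    ∃ (J : Finset (A.Points ℂ)) (n : A.Points ℂ → ℤ),
      z = ∑ P ∈ J, n P • A.pointClass P ∧ ChowGroup.degree A.X z = ∑ P ∈ J, n P := by
  classical
  induction z using ChowGroup.induction_on with
  | h c =>
    have hfin := finite_support_of_compactSpace (c : AlgebraicCycle A.X.left ℤ)
    have h0 : ∀ z ∈ hfin.toFinset, height z = ((0 : ℕ) : ℕ∞) := fun z hz =>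
      c.2 z (hfin.mem_toFinset.mp hz)
    have h0' : ∀ z ∈ hfin.toFinset, height z = 0 := fun z hz => (h0 z hz).trans Nat.cast_zero
    have hcl : ∀ z ∈ hfin.toFinset, IsClosed ({z} : Set A.X.left) := fun z hz =>
      isClosed_singleton_of_height_eq_zero (h0' z hz)
    -- the complex points over the support
    obtain ⟨pt', hpt'⟩ : ∃ pt' : hfin.toFinset → A.Points ℂ, ∀ z, (pt' z).pt = z.1 :=
      ⟨fun z => A.pointOfClosed z.1 (hcl z.1 z.2), fun z => A.pt_pointOfClosed z.1 (hcl z.1 z.2)⟩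
    have hinj : Function.Injective pt' := fun a b h => Subtype.ext (by rw [← hpt' a, ← hpt' b, h])
    refine ⟨Finset.univ.image pt', fun P => (c : AlgebraicCycle A.X.left ℤ) P.pt, ?_, ?_⟩
    · rw [Finset.sum_image fun a _ b _ h => hinj h]
      have hc : ChowGroup.mk A.X.left 0 c =
          ∑ z ∈ hfin.toFinset.attach, (c : AlgebraicCycle A.X.left ℤ) z •
            ChowGroup.ofPoint z.1 (h0 z.1 z.2) := by
        have hsum := eq_sum_smul_primeCycle_of_finite (c : AlgebraicCycle A.X.left ℤ) hfin
        have : c = ∑ z ∈ hfin.toFinset.attach, (c : AlgebraicCycle A.X.left ℤ) z •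
            (⟨primeCycle z.1, primeCycle_mem_cyclesOfDim (h0 z.1 z.2)⟩ : ↥(cyclesOfDim A.X.left 0)) := by
          apply Subtype.ext
          rw [AddSubgroup.val_finsetSum]
          simp only [AddSubgroup.coe_zsmul]
          conv_lhs => rw [hsum]
          exact (Finset.sum_attach _ fun z => (c : AlgebraicCycle A.X.left ℤ) z • primeCycle z).symm
        conv_lhs => rw [this]
        rw [map_sum]
        simp only [map_zsmul]
        rfl
      rw [hc]
      refine Finset.sum_congr rfl fun z _ => ?_
      dsimp only
      rw [pointClass_eq_ofPoint, ChowGroup.ofPoint_congr (hpt' z) (h0 z.1 z.2), hpt' z]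
    · rw [Finset.sum_image fun a _ b _ h => hinj h, ChowGroup.degree_mk_eq_finsum]
      rw [finsum_eq_sum_of_support_subset _ (s := hfin.toFinset) ?_]
      · rw [← Finset.sum_attach]
        refine Finset.sum_congr rfl fun z _ => ?_
        rw [hpt' z, ChowGroup.residueDegree_toSpecOver_eq_one_of_isAlgClosed (h0' z.1 z.2),
          Nat.cast_one, mul_one]
      · intro z hz
        rw [Function.mem_support] at hz
        exact hfin.coe_toFinset.symm ▸ (left_ne_zero_of_mul hz)

/-! ### The operators `c₁(t_x^* 𝒪_A(1)) ∩ -` -/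

section Operators

variable {A}
variable {d : ℕ} (j : A.X ⟶ projectiveSpace d ℂ)
  {ℓ : MvPolynomial (Fin (d + 1)) ℂ} (hℓ : ℓ ∈ grading (Fin (d + 1)) ℂ 1) (hℓ0 : ℓ ≠ 0)
  (hX : (formDivisor ℓ hℓ hℓ0).Avoids (j.left (genericPoint A.X.left)))

/-- **The hyperplane section `H = V₊(ℓ)|_A`** of the embedding `j : A ↪ ℙ^d` (an effective Cartier
divisor on `A` with `𝒪_A(H) = j^*𝒪(1)`). [cite: Fulton1998, §2.5 (p. 41)] -/
def hypDiv : CartierDivisor A.X.left :=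
  (formDivisor ℓ hℓ hℓ0).pullbackAvoiding j.left hX

/-- The translated embedding `t_x ≫ j : A ↪ ℙ^d` is a closed immersion. [folklore] -/
instance isClosedImmersion_translation_comp_left [IsClosedImmersion j.left] (x : A.Points ℂ) :
    IsClosedImmersion (A.translation x ≫ j).left := by
  rw [Over.comp_left]; infer_instance

include hX in
/-- `V₊(ℓ)` stays off `A` translated: it avoids `j(t_x(η_A)) = j(η_A)`. [folklore] -/
theorem formDivisor_avoids_translation_comp (x : A.Points ℂ) :
    (formDivisor ℓ hℓ hℓ0).Avoids ((A.translation x ≫ j).left (genericPoint A.X.left)) := by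
  haveI := irreducibleSpace_left A
  have e : (A.translation x ≫ j).left (genericPoint A.X.left) =
      j.left ((A.translation x).left (genericPoint A.X.left)) := by
    rw [Over.comp_left, Scheme.Hom.comp_apply]
  rw [e, RatFn.genericPoint_eq_of_isDominant (A.translation x).left]
  exact hX

/-- **`c₁(t_x^* 𝒪_A(1)) ∩ - : CH_{n+1}(A) → CH_n(A)`**: the operation `c₁(𝒪(1)) ∩ -` (Fulton §2.5
with Cor. 2.4.1; the tree's `ProjSpace.hyperplaneSectionOn`) of the translated closed immersion
`t_x ≫ j : A ↪ ℙ^d`, i.e. intersection with the translated hyperplane section `t_x^* H`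
(`transHypOp_mk`). [cite: Fulton1998, §2.5 (p. 41) and Cor. 2.4.1 (p. 38)] -/
def transHypOp [IsClosedImmersion j.left] (x : A.Points ℂ) (n : ℕ) :
    ChowGroup A.X.left (n + 1) →+ ChowGroup A.X.left n :=
  hyperplaneSectionOn (A.translation x ≫ j) hℓ hℓ0 (formDivisor_avoids_translation_comp j hℓ hℓ0 hX x) n

/-- `(t_x ≫ j)^* V₊(ℓ)` is the divisor `t_x^* H` (same divisor): `(t_x ≫ j)^* = t_x^* ∘ j^*` on
honest pull-backs, and along the dominant `t_x` the honest pull-back is `CartierDivisor.pullback`.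
[folklore] -/
theorem pullbackAvoiding_translation_comp_sameDivisor (x : A.Points ℂ) :
    ((formDivisor ℓ hℓ hℓ0).pullbackAvoiding (A.translation x ≫ j).left
        (formDivisor_avoids_translation_comp j hℓ hℓ0 hX x)).SameDivisor
      ((hypDiv j hℓ hℓ0 hX).pullback (A.translation x).left) := by
  have h0 : (formDivisor ℓ hℓ hℓ0).Avoids (j.left ((A.translation x).left (genericPoint A.X.left))) := by
    have h := formDivisor_avoids_translation_comp j hℓ hℓ0 hX x
    rwa [Over.comp_left, Scheme.Hom.comp_apply] at h
  have e : (A.translation x ≫ j).left = (A.translation x).left ≫ j.left := rfl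
  refine ((formDivisor ℓ hℓ hℓ0).pullbackAvoiding_congr_sameDivisor e _ h0).trans ?_
  refine (pullbackAvoiding_comp_sameDivisor j.left (A.translation x).left h0 hX).trans ?_
  exact pullbackAvoiding_sameDivisor_pullback (A.translation x).left (hypDiv j hℓ hℓ0 hX) _

/-- **`c₁(t_x^* 𝒪_A(1)) ∩ [c] = [t_x^* H · c]`** (Fulton Def. 2.3: intersecting with the Cartier
divisor `t_x^* H`; any divisor in the class gives the same result, Lemma 2.2 /
`SameDivisor.interCycle_sub_interCycle_mem`). [cite: Fulton1998, Def. 2.3 (p. 33)] -/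
theorem transHypOp_mk [IsClosedImmersion j.left] (x : A.Points ℂ) (n : ℕ)
    (c : ↥(cyclesOfDim A.X.left (n + 1))) :
    transHypOp j hℓ hℓ0 hX x n (ChowGroup.mk A.X.left (n + 1) c) =
      ChowGroup.mk A.X.left n
        ⟨((hypDiv j hℓ hℓ0 hX).pullback (A.translation x).left).interCycle c,
          interCycle_mem_cyclesOfDim _ c.2⟩ := by
  rw [transHypOp, hyperplaneSectionOn_mk, ChowGroup.mk_eq_mk_iff]
  exact ratTrivialOn_le_ratTrivial
    ((pullbackAvoiding_translation_comp_sameDivisor j hℓ hℓ0 hX x).interCycle_sub_interCycle_mem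
      c.2 (finite_support_of_compactSpace (c : AlgebraicCycle A.X.left ℤ)))

/-- `t_1^* H` is `H` (same divisor; `t_1 = 𝟙`). [folklore] -/
theorem pullback_translation_one_sameDivisor :
    ((hypDiv j hℓ hℓ0 hX).pullback (A.translation 1).left).SameDivisor (hypDiv j hℓ hℓ0 hX) := by
  haveI : IsDominant (𝟙 A.X.left) := inferInstance
  have e : (A.translation (1 : A.Points ℂ)).left = 𝟙 A.X.left := by rw [translation_one]; rfl
  exact ((hypDiv j hℓ hℓ0 hX).pullback_congr_sameDivisor e).trans
    (hypDiv j hℓ hℓ0 hX).pullback_id_sameDivisor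

/-- **The square law for `c₁(t_x^*𝒪_A(1)) ∩ -`** (the theorem of the square, Mumford §6 Cor. 4:
`t_{xy}^* H + H ∼ t_x^* H + t_y^* H`, the tree's `AbelianVariety.theoremOfTheSquare_holds`; and
Fulton Prop. 2.3 (b), Def. 2.3: `D · α` is additive in `D` and depends only on the class of `D`,
`interCycle_add_sub_mem`, `LinEquiv.interCycle_sub_interCycle_mem`):
`c₁(t_{xy}^*𝒪(1)) ∩ - + c₁(𝒪(1)) ∩ - = c₁(t_x^*𝒪(1)) ∩ - + c₁(t_y^*𝒪(1)) ∩ -` on `CH_{n+1}(A)`.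
[cite: MumfordAV1970, §6 Cor. 4] [cite: Fulton1998, Prop. 2.3 (b) (p. 34)] -/
theorem transHypOp_mul_add [IsClosedImmersion j.left] (x y : A.Points ℂ) (n : ℕ) :
    transHypOp j hℓ hℓ0 hX (x * y) n + transHypOp j hℓ hℓ0 hX 1 n =
      transHypOp j hℓ hℓ0 hX x n + transHypOp j hℓ hℓ0 hX y n := by
  ext z
  induction z using ChowGroup.induction_on with
  | h c =>
    set H := hypDiv j hℓ hℓ0 hX with hH
    have hfin := finite_support_of_compactSpace (c : AlgebraicCycle A.X.left ℤ)
    simp only [AddMonoidHom.add_apply, transHypOp_mk]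
    rw [← map_add, ← map_add, ChowGroup.mk_eq_mk_iff]
    change ((H.pullback (A.translation (x * y)).left).interCycle c +
        (H.pullback (A.translation 1).left).interCycle c) -
      ((H.pullback (A.translation x).left).interCycle c +
        (H.pullback (A.translation y).left).interCycle c) ∈ ratTrivial A.X.left n
    have hsq := A.theoremOfTheSquare_holds x y H
    have h2 := ratTrivialOn_le_ratTrivial
      (interCycle_add_sub_mem (H.pullback (A.translation (x * y)).left) H c.2 hfin)
    have h3 := ratTrivialOn_le_ratTrivial
      (interCycle_add_sub_mem (H.pullback (A.translation x).left)
        (H.pullback (A.translation y).left) c.2 hfin)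
    have h4 := ratTrivialOn_le_ratTrivial (hsq.interCycle_sub_interCycle_mem c.2 hfin)
    have h5 := ratTrivialOn_le_ratTrivial
      ((pullback_translation_one_sameDivisor j hℓ hℓ0 hX).interCycle_sub_interCycle_mem c.2 hfin)
    have key : ((H.pullback (A.translation (x * y)).left).interCycle c +
          (H.pullback (A.translation 1).left).interCycle c) -
        ((H.pullback (A.translation x).left).interCycle c +
          (H.pullback (A.translation y).left).interCycle c) =
      -((H.pullback (A.translation (x * y)).left + H).interCycle c -
          ((H.pullback (A.translation (x * y)).left).interCycle c + H.interCycle c)) +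
        ((H.pullback (A.translation (x * y)).left + H).interCycle c -
          (H.pullback (A.translation x).left + H.pullback (A.translation y).left).interCycle c) +
        ((H.pullback (A.translation x).left + H.pullback (A.translation y).left).interCycle c -
          ((H.pullback (A.translation x).left).interCycle c +
            (H.pullback (A.translation y).left).interCycle c)) +
        ((H.pullback (A.translation 1).left).interCycle c - H.interCycle c) := by
      abel
    rw [key]
    exact add_mem (add_mem (add_mem (neg_mem h2) h4) h3) h5

/-- **Projection formula along the translation `t_x`** (Fulton Prop. 2.3 (c), the tree's
`CartierDivisor.map_interCycle_pullback_sub_mem`, for the proper dominant `t_x` and `D = H`):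
`t_{x*}(c₁(t_x^*𝒪(1)) ∩ α) = c₁(𝒪(1)) ∩ t_{x*} α`. [cite: Fulton1998, Prop. 2.3 (c) (p. 34)] -/
theorem pushforward_transHypOp [IsClosedImmersion j.left] (x : A.Points ℂ) (n : ℕ)
    (z : ChowGroup A.X.left (n + 1)) :
    ChowGroup.pushforward n (map_mem_ratTrivial_holds n) (A.translation x)
        (transHypOp j hℓ hℓ0 hX x n z) =
      transHypOp j hℓ hℓ0 hX 1 n
        (ChowGroup.pushforward (n + 1) (map_mem_ratTrivial_holds (n + 1)) (A.translation x) z) := by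
  induction z using ChowGroup.induction_on with
  | h c =>
    set H := hypDiv j hℓ hℓ0 hX with hH
    have hfin := finite_support_of_compactSpace (c : AlgebraicCycle A.X.left ℤ)
    rw [transHypOp_mk, ChowGroup.pushforward_mk, ChowGroup.pushforward_mk, transHypOp_mk,
      ChowGroup.mk_eq_mk_iff]
    change AlgebraicCycle.map (A.translation x).left height height
        ((H.pullback (A.translation x).left).interCycle c) -
      (H.pullback (A.translation 1).left).interCycle
        (AlgebraicCycle.map (A.translation x).left height height c) ∈ ratTrivial A.X.left n
    have hpf := ratTrivialOn_le_ratTrivial (map_interCycle_pullback_sub_mem (A.translation x) H c.2 hfin)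
    have hfin' := finite_support_of_compactSpace
      (AlgebraicCycle.map (A.translation x).left height height (c : AlgebraicCycle A.X.left ℤ))
    have h1 := ratTrivialOn_le_ratTrivial
      ((pullback_translation_one_sameDivisor j hℓ hℓ0 hX).symm.interCycle_sub_interCycle_mem
        (map_mem_cyclesOfDim (A.translation x).left c.2) hfin')
    have key := add_mem hpf h1
    rwa [sub_add_sub_cancel] at key

end Operators

end AbelianVariety

end Literature.AlgebraicGeometry.Motives

end
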